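import Summits.AtomisticToContinuum.HydrodynamicLimit.Theorems.JParityClosureParityBandClosureStressIsotropyOfWindowCovarianceB
import Literature.Analysis.FluidPDE.CollisionalTransferFunctional
import Literature.Analysis.FluidPDE.HardSphereDynamicsProofs
import HarnessLib

/-!
# Window-to-cone step of `ParityBandClosure` — helper C: `L¹(dx₀)` time moduli of the cone fields
# along a hard-sphere trajectory

Support file for the stub `stub_stressIsotropyOfWindowCovariance` of the line `transfer-weighted-parity-chain`
(skeleton v4) of the crux `JParityClosure.ParityBandClosure` (stmt-AtomisticToContinuum-17608).

WHAT.  Along ONE hard-sphere trajectory `γ` on `𝕋³` (`N + 1` spheres of diameter `ε`), for `a ≤ b` and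
`0 < r < 1/2`:

* `dist_le_of_freeFlight_of_jump` — an abstract BALANCE INEQUALITY: a pseudo-distance `Q` on configurations
  (triangle inequality) which grows at most linearly under free flight (`Q(z, S_u z) ≤ uB` along the orbit) and
  jumps by at most `J(t)` at the collision times satisfies `Q(γ a, γ b) ≤ (b − a)B + Σ_{t_c ∈ (a,b]} J(t_c)`
  (induction on the number of collisions in `(a, b]`, splitting at the first one, as in the weak balance law
  `IsHardSphereTrajectory.sub_eq_integral_add_collisionalTransfer`);
* `integral_abs_rhoC_sub_le` — DENSITY: `∫ |ρ_r(γ b) − ρ_r(γ a)| dx₀ ≤ (b − a)(8/r)(½ + ke)` (positions are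
  continuous: no jump term; `ke` the conserved kinetic energy per particle);
* `integral_norm_momC_sub_le` — MOMENTUM: `∫ ‖m_r(γ b) − m_r(γ a)‖ dx₀ ≤ (b − a)(8/r)(2 ke) + (N+1)⁻¹(8ε/r)·½𝒮(a,b]`
  with `𝒮` the windowed normal-speed-jump functional `collisionalTransferFunctional … (‖vᵢ⁺ − vᵢ⁻‖)` of
  `JParityClosureAssemblyMomentumModulus.lean` (at a binary collision the momentum jump is
  `(b_r(xᵢ,·) − b_r(xⱼ,·)) Δvᵢ` with `d(xᵢ, xⱼ) = ε`).

Integrating over the field point `x₀` is what localises the transport term: no local energy / locality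
bookkeeping is needed, only the conserved total energy.  No fact of the line is used.

REFERENCES.  S. Chapman, T. G. Cowling, *The Mathematical Theory of Non-uniform Gases* (1970) §16.4
(collisional transfer); the trajectory kit is `Literature/Analysis/FluidPDE/CollisionalTransfer*.lean`.
-/

noncomputable section

namespace Summit.AtomisticToContinuum.HydrodynamicLimit.Theorems.ParityBandClosureWindowToCone

open scoped BigOperators Topology Classical MeasureTheory ENNReal InnerProductSpace
open Filter Set MeasureTheory Function
open Literature.MathematicalPhysics.KineticTheory
open Literature.Analysis.FluidPDE
open Literature.Analysis.FunctionSpaces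
open Summit.AtomisticToContinuum.HydrodynamicLimit.Theorems.LocalSecondLawNegative
open Summit.AtomisticToContinuum.HydrodynamicLimit.Theorems.LocalSecondLawLedger
open Summit.AtomisticToContinuum.HydrodynamicLimit.Theorems.LocalSecondLawLedger.L
  (rhoC_eq_sum momC_eq_sum)
open Summit.AtomisticToContinuum.HydrodynamicLimit.Theorems.ChaosClosesEulerReduction
open Summit.AtomisticToContinuum.HydrodynamicLimit.Theorems.ChaosClosesEulerStressIsotropy

/-! ## §1 The abstract balance inequality along a hard-sphere trajectory -/

section Abstract

variable {d : Type*} [Fintype d] {X : Type*} [TopologicalSpace X] [T2Space X] {n : ℕ}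
  {G : Geometry d X} {ε : ℝ} {γ : ℝ → Config n d X}

omit [T2Space X] in
/-- Additivity of a collision-indexed `finsum` in the window: `(a, b] ∪ (b, c]`. [folklore] -/
theorem finsum_jumps_add_adjacent (h : IsHardSphereTrajectory G ε n γ) (J : ℝ → ℝ) {a b c : ℝ}
    (hab : a ≤ b) (hbc : b ≤ c) :
    (∑ᶠ t ∈ collisionTimes G ε γ ∩ Ioc a b, J t) + (∑ᶠ t ∈ collisionTimes G ε γ ∩ Ioc b c, J t) =
      ∑ᶠ t ∈ collisionTimes G ε γ ∩ Ioc a c, J t := by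
  -- adapted from `IsHardSphereTrajectory.collisionalTransfer_add_adjacent`
  rw [← Ioc_union_Ioc_eq_Ioc hab hbc, inter_union_distrib_left,
    finsum_mem_union _ (h.finite_collisionTimes_inter_Ioc a b) (h.finite_collisionTimes_inter_Ioc b c)]
  exact Disjoint.mono inter_subset_right inter_subset_right (Ioc_disjoint_Ioc_of_le le_rfl)

omit [TopologicalSpace X] [T2Space X] in
/-- If `T` is the only collision time in `(a, T]`, the collision-indexed `finsum` over `(a, T]` is the term at
`T`. [folklore] -/
theorem finsum_jumps_eq_single (J : ℝ → ℝ) {a T : ℝ} (haT : a < T) (hT : T ∈ collisionTimes G ε γ)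
    (hfree : ∀ σ ∈ Ioo a T, σ ∉ collisionTimes G ε γ) :
    ∑ᶠ t ∈ collisionTimes G ε γ ∩ Ioc a T, J t = J T := by
  -- adapted from `collisionalTransfer_eq_collisionJump`
  have hset : collisionTimes G ε γ ∩ Ioc a T = {T} := by
    refine Set.eq_singleton_iff_unique_mem.2 ⟨⟨hT, haT, le_rfl⟩, fun σ hσ => ?_⟩
    rcases hσ.2.2.eq_or_lt with h' | hlt
    · exact h'
    · exact absurd hσ.1 (hfree σ ⟨hσ.2.1, hlt⟩)
  rw [hset, finsum_mem_singleton]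

omit [TopologicalSpace X] [T2Space X] in
/-- Over a window free of collisions the collision-indexed `finsum` vanishes. [folklore] -/
theorem finsum_jumps_eq_zero_of_free (J : ℝ → ℝ) {a b : ℝ} (hfree : ∀ σ ∈ Ioc a b, σ ∉ collisionTimes G ε γ) :
    ∑ᶠ t ∈ collisionTimes G ε γ ∩ Ioc a b, J t = 0 := by
  have : collisionTimes G ε γ ∩ Ioc a b = ∅ := Set.eq_empty_iff_forall_notMem.2 fun t ht => hfree t ht.2 ht.1
  rw [this, finsum_mem_empty]

/-- **The balance inequality along a hard-sphere trajectory.**  Let `Q` be a pseudo-distance on configurations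
(triangle inequality) such that, along the trajectory, free flight moves `Q` at rate `≤ B`
(`Q(γ s, S_u(γ s)) ≤ uB` for `u ≥ 0`) and the jump at each collision time `t` is `≤ J t`.  Then for `a ≤ b`:
`Q(γ a, γ b) ≤ (b − a)B + Σᶠ_{t ∈ collisionTimes ∩ (a,b]} J t`. [folklore] -/
theorem dist_le_of_freeFlight_of_jump (h : IsHardSphereTrajectory G ε n γ) (hG : ∀ x : X, Continuous (G.translate x))
    (Q : Config n d X → Config n d X → ℝ) (htri : ∀ u v w, Q u w ≤ Q u v + Q v w) {B : ℝ}
    (hff : ∀ s u : ℝ, 0 ≤ u → Q (γ s) (freeFlight G u (γ s)) ≤ u * B) {J : ℝ → ℝ}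
    (hjump : ∀ t ∈ collisionTimes G ε γ, Q (Function.leftLim γ t) (γ t) ≤ J t) {a b : ℝ} (hab : a ≤ b) :
    Q (γ a) (γ b) ≤ (b - a) * B + ∑ᶠ t ∈ collisionTimes G ε γ ∩ Ioc a b, J t := by
  -- adapted from `IsHardSphereTrajectory.sub_eq_integral_add_collisionalTransfer` (induction on the collisions)
  classical
  suffices H : ∀ (m : ℕ) (a : ℝ), a ≤ b → (h.finite_collisionTimes_inter_Ioc a b).toFinset.card = m →
      Q (γ a) (γ b) ≤ (b - a) * B + ∑ᶠ t ∈ collisionTimes G ε γ ∩ Ioc a b, J t from H _ a hab rfl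
  intro m
  induction m with
  | zero =>
    intro a hab hcard
    rw [Finset.card_eq_zero] at hcard
    have hfree : ∀ σ ∈ Ioc a b, σ ∉ collisionTimes G ε γ := fun σ hσ hcol =>
      Finset.notMem_empty σ (hcard ▸ (Set.Finite.mem_toFinset _).2 ⟨hcol, hσ⟩)
    rw [finsum_jumps_eq_zero_of_free J hfree, add_zero, h.eq_freeFlight hab hfree]
    exact hff a (b - a) (sub_nonneg.2 hab)
  | succ m ih =>
    intro a hab hcard
    set S := (h.finite_collisionTimes_inter_Ioc a b).toFinset with hS
    have hne : S.Nonempty := Finset.card_pos.1 (by omega)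
    have hTmem : S.min' hne ∈ collisionTimes G ε γ ∩ Ioc a b := (Set.Finite.mem_toFinset _).1 (S.min'_mem hne)
    set T := S.min' hne with hT
    have haT : a < T := hTmem.2.1
    have hTb : T ≤ b := hTmem.2.2
    have hmemS : ∀ {σ}, σ ∈ collisionTimes G ε γ → a < σ → σ ≤ b → σ ∈ S := fun hσ haσ hσb =>
      (Set.Finite.mem_toFinset _).2 ⟨hσ, haσ, hσb⟩
    have hfree : ∀ σ ∈ Ioo a T, σ ∉ collisionTimes G ε γ := fun σ hσ hcol =>
      (not_lt.2 (S.min'_le σ (hmemS hcol hσ.1 (hσ.2.le.trans hTb)))) hσ.2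
    have hcard' : (h.finite_collisionTimes_inter_Ioc T b).toFinset.card = m := by
      have hE : (h.finite_collisionTimes_inter_Ioc T b).toFinset = S.erase T := by
        ext σ
        simp only [Set.Finite.mem_toFinset, Finset.mem_erase, mem_inter_iff, mem_Ioc]
        constructor
        · rintro ⟨hσ, hTσ, hσb⟩
          exact ⟨hTσ.ne', hmemS hσ (haT.trans hTσ) hσb⟩
        · rintro ⟨hne', hσS⟩
          obtain ⟨hσ, haσ, hσb⟩ := (Set.Finite.mem_toFinset _).1 hσS
          exact ⟨hσ, lt_of_le_of_ne (S.min'_le σ hσS) (Ne.symm hne'), hσb⟩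
      rw [hE, Finset.card_erase_of_mem (S.min'_mem hne), hcard]
      rfl
    have h3 := ih T hTb hcard'
    have h1 : Q (γ a) (Function.leftLim γ T) ≤ (T - a) * B := by
      rw [h.leftLim_eq_freeFlight hG haT hfree]
      exact hff a (T - a) (sub_nonneg.2 haT.le)
    have h2 : Q (Function.leftLim γ T) (γ T) ≤ J T := hjump T hTmem.1
    rw [← finsum_jumps_add_adjacent h J haT.le hTb, finsum_jumps_eq_single J haT hTmem.1 hfree]
    calc Q (γ a) (γ b) ≤ Q (γ a) (Function.leftLim γ T) + (Q (Function.leftLim γ T) (γ T) + Q (γ T) (γ b)) :=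
          (htri _ _ _).trans (add_le_add le_rfl (htri _ _ _))
      _ ≤ (T - a) * B + (J T + ((b - T) * B + ∑ᶠ t ∈ collisionTimes G ε γ ∩ Ioc T b, J t)) := by
          gcongr
      _ = (b - a) * B + (J T + ∑ᶠ t ∈ collisionTimes G ε γ ∩ Ioc T b, J t) := by ring

end Abstract

/-! ## §2 The trajectory on `𝕋³`: energy bookkeeping -/

variable {N : ℕ}

/-- `(N+1)⁻¹ Σ ‖vᵢ‖² = 2 ke`. [folklore] -/
theorem mean_norm_sq_eq_two_ke (w : Phase N) : ((N + 1 : ℕ) : ℝ)⁻¹ * ∑ i, ‖(w i).2‖ ^ 2 = 2 * ke w := by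
  unfold ke; rw [← Finset.sum_div]; ring

/-- Conservation of `ke` along a hard-sphere trajectory. [folklore] -/
theorem ke_traj_eq {ε : ℝ} {γ : ℝ → Phase N} (h : IsHardSphereTrajectory (Torus.geometry (Fin 3)) ε (N + 1) γ)
    (s t : ℝ) : ke (γ s) = ke (γ t) := by
  rw [ke_eq_configEnergy, ke_eq_configEnergy, IsHardSphereTrajectory.configEnergy_eq_holds h s t]

/-! ## §3 The `L¹(dx₀)` time modulus of the mollified density -/

/-- **`L¹(dx₀)` time modulus of the mollified density along a hard-sphere trajectory**:
`∫ |ρ_r(γ b) − ρ_r(γ a)| dx₀ ≤ (b − a)(8/r)(½ + ke)` for `a ≤ b`, `0 < r < 1/2`. [folklore] -/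
theorem integral_abs_rhoC_sub_le {ε : ℝ} {γ : ℝ → Phase N}
    (h : IsHardSphereTrajectory (Torus.geometry (Fin 3)) ε (N + 1) γ) {r : ℝ} (hr : 0 < r) (hr2 : r < 1 / 2)
    {a b : ℝ} (hab : a ≤ b) :
    ∫ x, |rhoC r (γ b) x - rhoC r (γ a) x| ≤ (b - a) * (8 / r * (1 / 2 + ke (γ a))) := by
  set Q : Phase N → Phase N → ℝ := fun z z' => ∫ x, |rhoC r z' x - rhoC r z x| with hQ
  have hint : ∀ z z' : Phase N, Integrable (fun x => rhoC r z' x - rhoC r z x) volume := fun z z' =>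
    integrable_of_continuous_T3 ((continuous_rhoC r z').sub (continuous_rhoC r z))
  have htri : ∀ u v w, Q u w ≤ Q u v + Q v w := by
    intro u v w
    simp only [hQ]
    rw [← integral_add (hint u v).abs (hint v w).abs]
    refine integral_mono (hint u w).abs ((hint u v).abs.add (hint v w).abs) fun x => ?_
    have e : rhoC r w x - rhoC r u x = (rhoC r v x - rhoC r u x) + (rhoC r w x - rhoC r v x) := by ring
    simp only [e]
    exact abs_add_le _ _
  have hff : ∀ s u : ℝ, 0 ≤ u → Q (γ s) (freeFlight (Torus.geometry (Fin 3)) u (γ s)) ≤ u * (8 / r * (1 / 2 + ke (γ a))) := by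
    intro s u hu
    simp only [hQ]
    refine (integral_abs_rhoC_freeFlight_sub_le hr hr2 hu (γ s)).trans ?_
    rw [show 8 * u / r * (((N + 1 : ℕ) : ℝ)⁻¹ * ∑ i, ‖(γ s i).2‖) = u * (8 / r * (((N + 1 : ℕ) : ℝ)⁻¹ * ∑ i, ‖(γ s i).2‖)) by ring]
    refine mul_le_mul_of_nonneg_left (mul_le_mul_of_nonneg_left ?_ (by positivity)) hu
    rw [← ke_traj_eq h s a]
    exact meanSpeed_le (γ s)
  have hjump : ∀ t ∈ collisionTimes (Torus.geometry (Fin 3)) ε γ, Q (Function.leftLim γ t) (γ t) ≤ (fun _ => (0 : ℝ)) t := by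
    intro t _
    simp only [hQ]
    have h0 : ∀ x, rhoC r (γ t) x - rhoC r (Function.leftLim γ t) x = 0 := fun x => by
      rw [rhoC_eq_of_pos_eq (fun k => (h.leftLim_apply_fst (fun x => continuous_const.add Torus.continuous_proj) t k).symm) x, sub_self]
    simp only [h0, abs_zero, integral_zero, le_refl]
  have key := dist_le_of_freeFlight_of_jump h (fun x => continuous_const.add Torus.continuous_proj) Q htri hff hjump hab
  simp only [finsum_zero, add_zero] at key
  simpa only [hQ, finsum_mem_zero] using key

/-! ## §4 The `L¹(dx₀)` time modulus of the mollified momentum -/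

/-- **`L¹(dx₀)` time modulus of the mollified momentum along a hard-sphere trajectory**:
`∫ ‖m_r(γ b) − m_r(γ a)‖ dx₀ ≤ (b − a)(8/r)(2 ke) + (N+1)⁻¹(8ε/r)·½𝒮(a,b]`, `𝒮` the windowed normal-speed-jump
functional (`a ≤ b`, `0 < r < 1/2`). [folklore] -/
theorem integral_norm_momC_sub_le {ε : ℝ} {γ : ℝ → Phase N}
    (h : IsHardSphereTrajectory (Torus.geometry (Fin 3)) ε (N + 1) γ) {r : ℝ} (hr : 0 < r) (hr2 : r < 1 / 2)
    {a b : ℝ} (hab : a ≤ b) :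
    ∫ x, ‖momC r (γ b) x - momC r (γ a) x‖ ≤ (b - a) * (8 / r * (2 * ke (γ a))) +
      ((N + 1 : ℕ) : ℝ)⁻¹ * (8 * ε / r) * (2⁻¹ *
        collisionalTransferFunctional (Torus.geometry (Fin 3)) ε
          (fun i _ pre post => ‖(post i).2 - (pre i).2‖) γ a b) := by
  set Q : Phase N → Phase N → ℝ := fun z z' => ∫ x, ‖momC r z' x - momC r z x‖ with hQ
  have hint : ∀ z z' : Phase N, Integrable (fun x => momC r z' x - momC r z x) volume := fun z z' =>
    integrable_of_continuous_T3 ((continuous_momC r z').sub (continuous_momC r z))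
  have htri : ∀ u v w, Q u w ≤ Q u v + Q v w := by
    intro u v w
    simp only [hQ]
    rw [← integral_add (hint u v).norm (hint v w).norm]
    refine integral_mono (hint u w).norm ((hint u v).norm.add (hint v w).norm) fun x => ?_
    have e : momC r w x - momC r u x = (momC r v x - momC r u x) + (momC r w x - momC r v x) := by abel
    simp only [e]
    exact norm_add_le _ _
  have hff : ∀ s u : ℝ, 0 ≤ u → Q (γ s) (freeFlight (Torus.geometry (Fin 3)) u (γ s)) ≤ u * (8 / r * (2 * ke (γ a))) := by
    intro s u hu
    simp only [hQ]
    refine (integral_norm_momC_freeFlight_sub_le hr hr2 hu (γ s)).trans (le_of_eq ?_)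
    rw [mean_norm_sq_eq_two_ke, ke_traj_eq h s a]
    ring
  -- the jump functional in `finsum` form
  set J : ℝ → ℝ := fun t => ((N + 1 : ℕ) : ℝ)⁻¹ * (8 * ε / r) * (2⁻¹ *
    ∑ p ∈ collidingPairs (Torus.geometry (Fin 3)) ε (γ t), ‖(γ t p.1).2 - (Function.leftLim γ t p.1).2‖) with hJ
  have hjump : ∀ t ∈ collisionTimes (Torus.geometry (Fin 3)) ε γ, Q (Function.leftLim γ t) (γ t) ≤ J t := by
    intro t ht
    obtain ⟨i, j, hij, hc⟩ := mem_collisionTimes.1 ht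
    have hpos : ∀ k, (γ t k).1 = (Function.leftLim γ t k).1 := fun k =>
      (h.leftLim_apply_fst (fun x => continuous_const.add Torus.continuous_proj) t k).symm
    have hvel : ∀ k, k ≠ i → k ≠ j → (γ t k).2 = (Function.leftLim γ t k).2 := fun k hki hkj => by
      rw [h.apply_eq_leftLim_apply_of_ne hij hc hki hkj]
    have hcons := h.vel_sub_leftLim_right_eq_neg hij hc
    have hd : Torus.euclidDist (Function.leftLim γ t i).1 (Function.leftLim γ t j).1 = ε := by
      rw [← hpos i, ← hpos j]; exact (mem_contactSet.1 hc).2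
    have hB := integral_norm_momC_exchange_sub_le hr hr2 hij hpos hvel hcons
    rw [hd] at hB
    simp only [hQ, hJ]
    refine hB.trans (le_of_eq ?_)
    rw [h.sum_collidingPairs_eq hij hc, hcons, norm_neg]
    ring
  have key := dist_le_of_freeFlight_of_jump h (fun x => continuous_const.add Torus.continuous_proj) Q htri hff hjump hab
  simp only [hQ] at key
  refine key.trans (le_of_eq ?_)
  congr 1
  simp only [hJ]
  rw [collisionalTransferFunctional_eq_sum _ (h.finite_collisionTimes_inter_Ioc a b),
    finsum_mem_eq_finite_toFinset_sum _ (h.finite_collisionTimes_inter_Ioc a b), Finset.mul_sum, Finset.mul_sum]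

/-! ## §5 Registered sub-goal -/

/-- **Registered sub-goal `stub_stressIsotropyOfWindowCovarianceC` (helper C of
`stub_stressIsotropyOfWindowCovariance`): the `L¹(dx₀)` time modulus of the mollified density along a
hard-sphere trajectory on `𝕋³`** — `∫ |ρ_r(γ b) − ρ_r(γ a)| dx₀ ≤ (b − a)(8/r)(½ + ke(γ a))`. [folklore] -/
theorem stub_stressIsotropyOfWindowCovarianceC : ∀ {N : ℕ} {ε : ℝ} {γ : ℝ → Config (N + 1) (Fin 3) T3}, IsHardSphereTrajectory (Torus.geometry (Fin 3)) ε (N + 1) γ → ∀ {r : ℝ}, 0 < r → r < 1 / 2 → ∀ {a b : ℝ}, a ≤ b → ∫ x : T3, |rhoC r (γ b) x - rhoC r (γ a) x| ≤ (b - a) * (8 / r * (1 / 2 + ke (γ a))) :=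
  fun h _ hr hr2 _ _ hab => integral_abs_rhoC_sub_le h hr hr2 hab

end Summit.AtomisticToContinuum.HydrodynamicLimit.Theorems.ParityBandClosureWindowToCone

end
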